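import Summits.Ventures.LatticeQCDFlow.Exactness.Phi4MetropolisMagnetisationCSD
import Summits.Ventures.LatticeQCDFlow.Exactness.ReversibleDirichletFloor
import HarnessLib

/-!
# The critical-slowing-down floor SHARPENED BY THE ACCEPTANCE RATE: `τ_int,sweep(M) ≥ 2χ/(δ² ā) − ½`

HONEST FRAMING: exact (Metropolis-corrected) sampling algorithms for lattice gauge theory;
figures of merit are autocorrelation/cost numbers at stated couplings and volumes; no
continuum-physics claim.  (SCALAR calibration rung S0-A: not a gauge result.)

Venture `LatticeQCDFlow` (cell pub-lqcd), topic `Exactness`; FANOUT row 2 (`s0-phi4`, LOCAL arm).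
NEW WORK of the cell, composing `ReversibleDirichletFloor` (averaged carré-du-champ floor) with the
random-site-scan Metropolis files (`Phi4MetropolisScan`, `Phi4MetropolisCSDFloor`,
`Phi4MetropolisScanEnvelope(DCT)`, `Phi4MetropolisMagnetisationCSD`).  Nothing is cited as a fact.
The point: a rejected proposal does not move the observable at all, so the mean one-step squared
displacement of `g` is at most `δ²` times the ACCEPTANCE PROBABILITY, and the locality floor of
`Phi4MetropolisCSDFloor` / `Phi4MetropolisMagnetisationCSD` improves by the factor `1/ā`, `ā` the
equilibrium acceptance rate — a leaderboard column of row 2's local arm (printed `≈ 0.70` at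
`δ ≈ 0.5` on the AKS 2019 sets; no number is used here).

## What is proved (`Λ = Fin (n+1)`, `λ > 0`, any `J`; `ρ` even probability density, `ρ = 0` off `[−δ, δ]`)

`a_x(φ) = ∫ min(1, e^{−ΔS}) ρ(t' − φ_x) dt'` the acceptance probability of the hit at `x` from `φ`,
`A(φ) = (1/(n+1)) Σ_x a_x(φ)` that of the random scan, `ā = ⟨A⟩` its equilibrium mean (= the long-run
fraction of accepted proposals of the scan AND of the ordered sweep, both being exact).

* `measurable_acceptRate`, `acceptRate_mem_Icc` — `A` is measurable with values in `[0, 1]`;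
* `metroSite_sq_dev_le_accept`, **`metroScan_sq_dev_le_accept`** — under the move bound
  (`ρ(t' − φ_x) ≠ 0 ⇒ (g(φ|φ_x:=t') − g φ)² ≤ D`): `K[(g − g φ)²](φ) ≤ D · A(φ)`;
  **`integral_metroScan_sq_dev_le`** — `∫ K[(g − g φ)²](φ) e^{−S} ≤ D ∫ A e^{−S}`;
* **`metropolisScan_tauInt_sweep_ge_accept`** — bounded measurable `f`, 1-Lipschitz in each
  coordinate, `g = f − ⟨f⟩`: summable sweep-thinned series and `ρ_g(n+1) < 1` ⇒
  `τ_int,sweep(f) ≥ 2 Var(f)/((n+1) δ² ā) − ½`;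
* **`metropolisScan_tauInt_sweep_ge_magnetisation_accept`** — the same for `M = Σ_x φ_x` itself:
  `τ_int,sweep(M) ≥ 2 Var(M)/((n+1) δ² ā) − ½ = 2χ/(δ² ā) − ½`;
* **`metropolisScan_tauInt_sweep_ge_magnetisation_msd`** — the sharpest form: with `⟨Γ_M⟩` the
  equilibrium mean squared one-step (accepted) displacement of `M` per proposal,
  `τ_int,sweep(M) ≥ 2χ/⟨Γ_M⟩ − ½` (and `⟨Γ_M⟩ ≤ δ² ā`).

Reading (no numerics implied): with `δ = 0.5` and a measured `ā = 0.7` the floor is `≈ 11.4 χ − ½`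
sweeps; as `δ` grows, `δ² ā(δ)` saturates (large proposals are rejected), so the floor does not
vanish — the certified form of the step-size trade-off.  NOT CLAIMED: the ordered sweep;
`ρ_g < 1` / summability (hypotheses); any value of `ā` or `χ`.
-/

namespace Summit.Ventures.LatticeQCDFlow.Exactness

open Real MeasureTheory Filter Finset
open Summit.Ventures.LatticeQCDFlow.Scoring

section AcceptanceCSD

variable {n : ℕ}

/-- The scan's acceptance probability from `φ` is measurable in `φ`. -/
theorem measurable_acceptRate (J : Fin (n + 1) → Fin (n + 1) → ℝ) (lam : ℝ) {ρ : ℝ → ℝ}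
    (hρm : Measurable ρ) :
    Measurable (fun φ : Fin (n + 1) → ℝ =>
      (∑ x, ∫ t', metroAccept J lam x φ t' * ρ (t' - φ x)) / ((n : ℝ) + 1)) := by
  refine (Finset.measurable_sum _ fun x _ => ?_).div_const _
  have hw : Measurable (gibbsWeight J lam) := (continuous_gibbsWeight J lam).measurable
  have hupd : Measurable fun p : (Fin (n + 1) → ℝ) × ℝ => Function.update p.1 x p.2 :=
    measurable_update'
  have ha : Measurable fun p : (Fin (n + 1) → ℝ) × ℝ => metroAccept J lam x p.1 p.2 := by
    unfold metroAccept
    exact measurable_const.min ((hw.comp hupd).div (hw.comp measurable_fst))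
  have hF : Measurable fun p : (Fin (n + 1) → ℝ) × ℝ =>
      metroAccept J lam x p.1 p.2 * ρ (p.2 - p.1 x) :=
    ha.mul (hρm.comp (measurable_snd.sub ((measurable_pi_apply x).comp measurable_fst)))
  exact hF.stronglyMeasurable.integral_prod_right'.measurable

/-- The scan's acceptance probability lies in `[0, 1]` (`ρ ≥ 0` a probability density). -/
theorem acceptRate_mem_Icc (J : Fin (n + 1) → Fin (n + 1) → ℝ) (lam : ℝ) {ρ : ℝ → ℝ}
    (hρ0 : ∀ u, 0 ≤ ρ u) (hρi : Integrable ρ) (hρ1 : ∫ u, ρ u = 1) (φ : Fin (n + 1) → ℝ) :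
    0 ≤ (∑ x, ∫ t', metroAccept J lam x φ t' * ρ (t' - φ x)) / ((n : ℝ) + 1)
      ∧ (∑ x, ∫ t', metroAccept J lam x φ t' * ρ (t' - φ x)) / ((n : ℝ) + 1) ≤ 1 := by
  have hn : (0 : ℝ) < (n : ℝ) + 1 := by positivity
  have hx : ∀ x : Fin (n + 1), 0 ≤ ∫ t', metroAccept J lam x φ t' * ρ (t' - φ x)
      ∧ ∫ t', metroAccept J lam x φ t' * ρ (t' - φ x) ≤ 1 := by
    intro x
    have hρt : Integrable (fun t' => ρ (t' - φ x)) := hρi.comp_sub_right (φ x)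
    have hρt1 : ∫ t', ρ (t' - φ x) = 1 := by
      rw [integral_sub_right_eq_self (μ := (volume : Measure ℝ)) ρ (φ x), hρ1]
    refine ⟨integral_nonneg fun t' => mul_nonneg (metroAccept_nonneg_le J lam x φ t').1 (hρ0 _), ?_⟩
    calc ∫ t', metroAccept J lam x φ t' * ρ (t' - φ x) ≤ ∫ t', ρ (t' - φ x) := by
          refine integral_mono_of_nonneg (Eventually.of_forall fun t' =>
            mul_nonneg (metroAccept_nonneg_le J lam x φ t').1 (hρ0 _)) hρt
            (Eventually.of_forall fun t' => ?_)
          have := (metroAccept_nonneg_le J lam x φ t').2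
          nlinarith [hρ0 (t' - φ x)]
      _ = 1 := hρt1
  refine ⟨div_nonneg (Finset.sum_nonneg fun x _ => (hx x).1) hn.le, ?_⟩
  rw [div_le_one hn]
  calc ∑ x, ∫ t', metroAccept J lam x φ t' * ρ (t' - φ x) ≤ ∑ _x : Fin (n + 1), (1 : ℝ) :=
        Finset.sum_le_sum fun x _ => (hx x).2
    _ = (n : ℝ) + 1 := by
        rw [Finset.sum_const, Finset.card_univ, Fintype.card_fin, nsmul_eq_mul, mul_one]
        push_cast
        ring

/-- **Rejections do not move**: under the move bound, the hit's carré du champ is at most `D` times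
its acceptance probability: `M_x[(g − g φ)²](φ) ≤ D · a_x(φ)`. -/
theorem metroSite_sq_dev_le_accept (J : Fin (n + 1) → Fin (n + 1) → ℝ) (lam : ℝ) {ρ : ℝ → ℝ}
    (hρ0 : ∀ u, 0 ≤ ρ u) (hρm : Measurable ρ) (hρi : Integrable ρ) (x : Fin (n + 1))
    {g : (Fin (n + 1) → ℝ) → ℝ} {D : ℝ} (φ : Fin (n + 1) → ℝ)
    (hmove : ∀ t', ρ (t' - φ x) ≠ 0 → (g (Function.update φ x t') - g φ) ^ 2 ≤ D) :
    metroSite J lam ρ x (fun ψ => (g ψ - g φ) ^ 2) φ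
      ≤ D * ∫ t', metroAccept J lam x φ t' * ρ (t' - φ x) := by
  have hρt : Integrable (fun t' => ρ (t' - φ x)) := hρi.comp_sub_right (φ x)
  have hw : Measurable (gibbsWeight J lam) := (continuous_gibbsWeight J lam).measurable
  have hupd : Measurable fun t' : ℝ => Function.update φ x t' := measurable_update φ
  have ha : Measurable fun t' => metroAccept J lam x φ t' := by
    unfold metroAccept
    exact measurable_const.min ((hw.comp hupd).div measurable_const)
  have hIa : Integrable (fun t' => metroAccept J lam x φ t' * ρ (t' - φ x)) := by
    refine Integrable.mono' hρt (ha.mul (hρm.comp (measurable_id.sub measurable_const))).aestronglyMeasurable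
      (Eventually.of_forall fun t' => ?_)
    obtain ⟨ha0, ha1⟩ := metroAccept_nonneg_le J lam x φ t'
    rw [Real.norm_eq_abs, abs_of_nonneg (mul_nonneg ha0 (hρ0 _))]
    nlinarith [hρ0 (t' - φ x)]
  unfold metroSite
  simp only [sub_self, zero_pow (two_ne_zero), mul_zero, add_zero]
  rw [← integral_const_mul]
  refine integral_mono_of_nonneg (Eventually.of_forall fun t' => ?_) (hIa.const_mul D)
    (Eventually.of_forall fun t' => ?_)
  · obtain ⟨ha0, -⟩ := metroAccept_nonneg_le J lam x φ t'
    exact mul_nonneg (mul_nonneg ha0 (sq_nonneg _)) (hρ0 _)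
  · obtain ⟨ha0, -⟩ := metroAccept_nonneg_le J lam x φ t'
    by_cases hz : ρ (t' - φ x) = 0
    · simp [hz]
    · have hD := hmove t' hz
      have : metroAccept J lam x φ t' * (g (Function.update φ x t') - g φ) ^ 2
          ≤ D * metroAccept J lam x φ t' := by nlinarith
      calc metroAccept J lam x φ t' * (g (Function.update φ x t') - g φ) ^ 2 * ρ (t' - φ x)
          ≤ D * metroAccept J lam x φ t' * ρ (t' - φ x) := mul_le_mul_of_nonneg_right this (hρ0 _)
        _ = D * (metroAccept J lam x φ t' * ρ (t' - φ x)) := by ring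

/-- **The scan's carré du champ is at most `D` times its acceptance probability**:
`K[(g − g φ)²](φ) ≤ D · A(φ)`. -/
theorem metroScan_sq_dev_le_accept (J : Fin (n + 1) → Fin (n + 1) → ℝ) (lam : ℝ) {ρ : ℝ → ℝ}
    (hρ0 : ∀ u, 0 ≤ ρ u) (hρm : Measurable ρ) (hρi : Integrable ρ) {g : (Fin (n + 1) → ℝ) → ℝ} {D : ℝ}
    (φ : Fin (n + 1) → ℝ)
    (hmove : ∀ x t', ρ (t' - φ x) ≠ 0 → (g (Function.update φ x t') - g φ) ^ 2 ≤ D) :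
    metroScan J lam ρ (fun ψ => (g ψ - g φ) ^ 2) φ
      ≤ D * ((∑ x, ∫ t', metroAccept J lam x φ t' * ρ (t' - φ x)) / ((n : ℝ) + 1)) := by
  have hn : (0 : ℝ) < (n : ℝ) + 1 := by positivity
  unfold metroScan
  rw [mul_div_assoc', div_le_div_iff_of_pos_right hn, Finset.mul_sum]
  exact Finset.sum_le_sum fun x _ => metroSite_sq_dev_le_accept J lam hρ0 hρm hρi x φ (hmove x)

/-- **Averaged move bound**: `∫ K[(g − g φ)²](φ) e^{−S} dφ ≤ D ∫ A e^{−S}` (coercive action). -/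
theorem integral_metroScan_sq_dev_le {J : Fin (n + 1) → Fin (n + 1) → ℝ} {lam ε K : ℝ}
    (hε : 0 < ε) (hS : ∀ φ : Fin (n + 1) → ℝ, ε * ∑ w, φ w ^ 2 - K ≤ latticePhi4Action J lam φ)
    {ρ : ℝ → ℝ} (hρ0 : ∀ u, 0 ≤ ρ u) (hρm : Measurable ρ) (hρi : Integrable ρ)
    (hρ1 : ∫ u, ρ u = 1) {g : (Fin (n + 1) → ℝ) → ℝ} {D : ℝ}
    (hmove : ∀ φ x t', ρ (t' - φ x) ≠ 0 → (g (Function.update φ x t') - g φ) ^ 2 ≤ D) :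
    ∫ φ, metroScan J lam ρ (fun ψ => (g ψ - g φ) ^ 2) φ * gibbsWeight J lam φ
      ≤ D * ∫ φ, (∑ x, ∫ t', metroAccept J lam x φ t' * ρ (t' - φ x)) / ((n : ℝ) + 1)
        * gibbsWeight J lam φ := by
  have hw := integrable_gibbsWeight_of_coercive hε hS
  have hAm := measurable_acceptRate J lam hρm (n := n)
  have hAb : ∀ φ, |(∑ x, ∫ t', metroAccept J lam x φ t' * ρ (t' - φ x)) / ((n : ℝ) + 1)| ≤ 1 :=
    fun φ => by
      obtain ⟨h0, h1⟩ := acceptRate_mem_Icc J lam hρ0 hρi hρ1 φ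
      rw [abs_of_nonneg h0]
      exact h1
  have hAi : Integrable (fun φ => (∑ x, ∫ t', metroAccept J lam x φ t' * ρ (t' - φ x))
      / ((n : ℝ) + 1) * gibbsWeight J lam φ) :=
    integrable_bdd_mul_weight (μ := volume) hAm hAb (continuous_gibbsWeight J lam).measurable
      (fun φ => (gibbsWeight_pos J lam φ).le) hw
  rw [← integral_const_mul]
  refine integral_mono_of_nonneg (Eventually.of_forall fun φ => ?_) (hAi.const_mul D)
    (Eventually.of_forall fun φ => ?_)
  · -- the scan of a nonnegative observable, evaluated anywhere, is nonnegative
    refine mul_nonneg ?_ (gibbsWeight_pos J lam φ).le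
    unfold metroScan
    refine div_nonneg (Finset.sum_nonneg fun x _ => ?_) (by positivity)
    unfold metroSite
    exact integral_nonneg fun t' => by
      obtain ⟨ha0, ha1⟩ := metroAccept_nonneg_le J lam x φ t'
      exact mul_nonneg (add_nonneg (mul_nonneg ha0 (sq_nonneg _))
        (mul_nonneg (sub_nonneg.2 ha1) (sq_nonneg _))) (hρ0 _)
  · have h := metroScan_sq_dev_le_accept J lam hρ0 hρm hρi φ (hmove φ)
    have hwφ := (gibbsWeight_pos J lam φ).le
    calc metroScan J lam ρ (fun ψ => (g ψ - g φ) ^ 2) φ * gibbsWeight J lam φ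
        ≤ D * ((∑ x, ∫ t', metroAccept J lam x φ t' * ρ (t' - φ x)) / ((n : ℝ) + 1))
          * gibbsWeight J lam φ := mul_le_mul_of_nonneg_right h hwφ
      _ = D * ((∑ x, ∫ t', metroAccept J lam x φ t' * ρ (t' - φ x)) / ((n : ℝ) + 1)
          * gibbsWeight J lam φ) := by ring

/-- The real-variable bookkeeping `2 (P/Z) / (V δ² (I/Z)) = 2 P / (V (δ² I))` (`Z ≠ 0`). -/
theorem accept_floor_transfer {Z : ℝ} (hZ : Z ≠ 0) (n : ℕ) (δ P I : ℝ) :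
    2 * (P / Z) / (((n : ℝ) + 1) * δ ^ 2 * (I / Z)) - 1 / 2
      = 2 * P / (((n + 1 : ℕ) : ℝ) * (δ ^ 2 * I)) - 1 / 2 := by
  push_cast
  rw [show ((n : ℝ) + 1) * δ ^ 2 * (I / Z) = ((n : ℝ) + 1) * (δ ^ 2 * I) / Z by ring,
    ← mul_div_assoc, div_div_div_cancel_right₀ hZ]

/-- **CSD FLOOR WITH THE ACCEPTANCE RATE, bounded coordinate-Lipschitz observables.**  `λ > 0`, any
`J`, `ρ` an even probability density vanishing outside `[−δ, δ]`, `f` bounded measurable and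
1-Lipschitz in each coordinate, `g = f − ⟨f⟩`, `K` the random-site scan, `ā = ⟨A⟩` its equilibrium
acceptance rate.  Summable sweep-thinned series and `ρ_g(n+1) < 1` ⇒
`τ_int,sweep(f) ≥ 2 ⟨(f − ⟨f⟩)²⟩ / ((n+1) δ² ā) − ½`. -/
theorem metropolisScan_tauInt_sweep_ge_accept {lam : ℝ} (hlam : 0 < lam)
    (J : Fin (n + 1) → Fin (n + 1) → ℝ) {ρ : ℝ → ℝ} (hρ0 : ∀ u, 0 ≤ ρ u) (hρm : Measurable ρ)
    (hρi : Integrable ρ) (hρ1 : ∫ u, ρ u = 1) (hρs : ∀ u, ρ (-u) = ρ u) {δ : ℝ}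
    (hρδ : ∀ u, δ < |u| → ρ u = 0) {f : (Fin (n + 1) → ℝ) → ℝ} (hf : BddObs f)
    (hlip : ∀ (φ : Fin (n + 1) → ℝ) (x : Fin (n + 1)) (t' : ℝ),
      |f (Function.update φ x t') - f φ| ≤ |t' - φ x|)
    (hs : Summable fun k => (∫ φ, (f φ - gibbsExpect J lam f)
        * ((metroScan J lam ρ)^[(n + 1) * (k + 1)] (fun ψ => f ψ - gibbsExpect J lam f)) φ
        * gibbsWeight J lam φ) / ∫ φ, (f φ - gibbsExpect J lam f) ^ 2 * gibbsWeight J lam φ)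
    (hρV : (∫ φ, (f φ - gibbsExpect J lam f)
        * ((metroScan J lam ρ)^[n + 1] (fun ψ => f ψ - gibbsExpect J lam f)) φ * gibbsWeight J lam φ)
        / (∫ φ, (f φ - gibbsExpect J lam f) ^ 2 * gibbsWeight J lam φ) < 1) :
    2 * gibbsExpect J lam (fun φ => (f φ - gibbsExpect J lam f) ^ 2)
        / ((n + 1) * δ ^ 2 * gibbsExpect J lam (fun φ =>
            (∑ x, ∫ t', metroAccept J lam x φ t' * ρ (t' - φ x)) / ((n : ℝ) + 1))) - 1 / 2
      ≤ tauInt (fun k => (∫ φ, (f φ - gibbsExpect J lam f)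
          * ((metroScan J lam ρ)^[(n + 1) * k] (fun ψ => f ψ - gibbsExpect J lam f)) φ
          * gibbsWeight J lam φ) / ∫ φ, (f φ - gibbsExpect J lam f) ^ 2 * gibbsWeight J lam φ) := by
  have hco := latticePhi4Action_coercive hlam J
  obtain ⟨hfm, B, hfb⟩ := hf
  obtain ⟨hgm, hgb, -⟩ := centred_observable hlam J hfm hfb
  have hg : BddObs (fun ψ => f ψ - gibbsExpect J lam f) := ⟨hgm, _, hgb⟩
  have hmove : ∀ (φ : Fin (n + 1) → ℝ) (x : Fin (n + 1)) (t' : ℝ), ρ (t' - φ x) ≠ 0 →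
      ((f (Function.update φ x t') - gibbsExpect J lam f) - (f φ - gibbsExpect J lam f)) ^ 2
        ≤ δ ^ 2 :=
    fun φ x t' hne => sq_sub_le_of_coordLipschitz hρδ hlip (gibbsExpect J lam f) φ x t' hne
  have hΓ := integral_metroScan_sq_dev_le (g := fun ψ => f ψ - gibbsExpect J lam f) (D := δ ^ 2)
    one_pos hco hρ0 hρm hρi hρ1 hmove
  have hfloor := RevOp.thinned_tauInt_ge_of_integral_carre_le (μ := volume) (A := BddObs)
    (K := metroScan J lam ρ) (w := gibbsWeight J lam)
    (fun φ => (gibbsWeight_pos J lam φ).le) (bddObs_const 1)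
    (fun f h hf hh => bddObs_integrable_mul_mul_gibbsWeight one_pos hco hf hh)
    (fun f h c hf hh => bddObs_add_mul hf hh c)
    (fun f hf => bddObs_metroScan J lam hρ0 hρm hρi hρ1 hf)
    (fun f h c hf hh x => metroScan_add_mul J lam hρ0 hρm hρi hf hh c x)
    (fun f h hf hh => metroScan_reversible one_pos hco hρ0 hρm hρi hρ1 hρs hf hh)
    (fun f hf => metroScan_contraction one_pos hco hρ0 hρm hρi hρ1 hρs hf)
    (fun φ => metroScan_one J lam hρ1 φ) hg (bddObs_sq hg) hΓ (show 0 < n + 1 by omega) hs hρV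
  have hZ : gibbsZ J lam ≠ 0 := (gibbsZ_pos hlam J).ne'
  exact (accept_floor_transfer hZ n δ _ _).le.trans hfloor

/-- **CSD FLOOR OF THE MAGNETISATION WITH THE ACCEPTANCE RATE.**  Same setting (`δ ≥ 0`),
`M = Σ_x φ_x`, `g = M − ⟨M⟩`: summable sweep-thinned series and `ρ_g(n+1) < 1` ⇒
`τ_int,sweep(M) ≥ 2 ⟨(M − ⟨M⟩)²⟩ / ((n+1) δ² ā) − ½ = 2χ/(δ² ā) − ½`. -/
theorem metropolisScan_tauInt_sweep_ge_magnetisation_accept {lam : ℝ} (hlam : 0 < lam)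
    (J : Fin (n + 1) → Fin (n + 1) → ℝ) {ρ : ℝ → ℝ} (hρ0 : ∀ u, 0 ≤ ρ u) (hρm : Measurable ρ)
    (hρi : Integrable ρ) (hρ1 : ∫ u, ρ u = 1) (hρs : ∀ u, ρ (-u) = ρ u) {δ : ℝ} (hδ : 0 ≤ δ)
    (hρδ : ∀ u, δ < |u| → ρ u = 0)
    (hs : Summable fun k => (∫ φ, ((∑ y, φ y) - gibbsExpect J lam (fun ψ => ∑ y, ψ y))
        * ((metroScan J lam ρ)^[(n + 1) * (k + 1)]
            (fun ψ => (∑ y, ψ y) - gibbsExpect J lam (fun ψ => ∑ y, ψ y))) φ * gibbsWeight J lam φ)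
        / ∫ φ, ((∑ y, φ y) - gibbsExpect J lam (fun ψ => ∑ y, ψ y)) ^ 2 * gibbsWeight J lam φ)
    (hρV : (∫ φ, ((∑ y, φ y) - gibbsExpect J lam (fun ψ => ∑ y, ψ y))
        * ((metroScan J lam ρ)^[n + 1]
            (fun ψ => (∑ y, ψ y) - gibbsExpect J lam (fun ψ => ∑ y, ψ y))) φ * gibbsWeight J lam φ)
        / (∫ φ, ((∑ y, φ y) - gibbsExpect J lam (fun ψ => ∑ y, ψ y)) ^ 2 * gibbsWeight J lam φ)
        < 1) :
    2 * gibbsExpect J lam (fun φ => ((∑ y, φ y) - gibbsExpect J lam (fun ψ => ∑ y, ψ y)) ^ 2)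
        / ((n + 1) * δ ^ 2 * gibbsExpect J lam (fun φ =>
            (∑ x, ∫ t', metroAccept J lam x φ t' * ρ (t' - φ x)) / ((n : ℝ) + 1))) - 1 / 2
      ≤ tauInt (fun k => (∫ φ, ((∑ y, φ y) - gibbsExpect J lam (fun ψ => ∑ y, ψ y))
        * ((metroScan J lam ρ)^[(n + 1) * k]
            (fun ψ => (∑ y, ψ y) - gibbsExpect J lam (fun ψ => ∑ y, ψ y))) φ * gibbsWeight J lam φ)
        / ∫ φ, ((∑ y, φ y) - gibbsExpect J lam (fun ψ => ∑ y, ψ y)) ^ 2 * gibbsWeight J lam φ) := by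
  have hco := latticePhi4Action_coercive hlam J
  set c := gibbsExpect J lam (fun ψ : Fin (n + 1) → ℝ => ∑ y, ψ y) with hc
  have hgm : Measurable (fun ψ : Fin (n + 1) → ℝ => (∑ y, ψ y) - c) :=
    (Finset.measurable_sum _ fun y _ => measurable_pi_apply y).sub measurable_const
  have hglin : ∀ φ : Fin (n + 1) → ℝ, |(∑ y, φ y) - c| ≤ (1 + |c|) * (1 + ∑ w, |φ w|) :=
    fun φ => magnetisation_linear_growth c φ
  have hg : QuadObs (fun ψ : Fin (n + 1) → ℝ => (∑ y, ψ y) - c) := quadObs_of_linear_growth hgm hglin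
  have hg2 : QuadObs (fun ψ : Fin (n + 1) → ℝ => ((∑ y, ψ y) - c) ^ 2) :=
    quadObs_sq_of_linear_growth hgm hglin
  have hmove : ∀ (φ : Fin (n + 1) → ℝ) (x : Fin (n + 1)) (t' : ℝ), ρ (t' - φ x) ≠ 0 →
      (((∑ y, Function.update φ x t' y) - c) - ((∑ y, φ y) - c)) ^ 2 ≤ δ ^ 2 :=
    fun φ x t' hne => magnetisation_move_sq_le hρδ c φ x t' hne
  have hΓ := integral_metroScan_sq_dev_le (g := fun ψ : Fin (n + 1) → ℝ => (∑ y, ψ y) - c)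
    (D := δ ^ 2) one_pos hco hρ0 hρm hρi hρ1 hmove
  have hfloor := RevOp.thinned_tauInt_ge_of_integral_carre_le (μ := volume) (A := QuadObs)
    (K := metroScan J lam ρ) (w := gibbsWeight J lam)
    (fun φ => (gibbsWeight_pos J lam φ).le) (quadObs_const 1)
    (fun f h hf hh => quadObs_integrable_mul_mul_gibbsWeight one_pos hco hf hh)
    (fun f h c hf hh => quadObs_add_mul hf hh c)
    (fun f hf => quadObs_metroScan J lam hρ0 hρm hρi hρ1 hδ hρδ hf)
    (fun f h c hf hh x => metroScan_add_mul_quad J lam hρ0 hρm hρi hδ hρδ hf hh c x)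
    (fun f h hf hh => metroScan_reversible_quad one_pos hco hρ0 hρm hρi hρ1 hρs hδ hρδ hf hh)
    (fun f hf => metroScan_contraction_quad one_pos hco hρ0 hρm hρi hρ1 hρs hδ hρδ hf)
    (fun φ => metroScan_one J lam hρ1 φ) hg hg2 hΓ (show 0 < n + 1 by omega) hs hρV
  have hZ : gibbsZ J lam ≠ 0 := (gibbsZ_pos hlam J).ne'
  exact (accept_floor_transfer hZ n δ _ _).le.trans hfloor

/-- The bookkeeping `2 (P/Z) / (V (I/Z)) = 2 P / (V I)` (`Z ≠ 0`). -/
theorem msd_floor_transfer {Z : ℝ} (hZ : Z ≠ 0) (n : ℕ) (P I : ℝ) :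
    2 * (P / Z) / (((n : ℝ) + 1) * (I / Z)) - 1 / 2
      = 2 * P / (((n + 1 : ℕ) : ℝ) * I) - 1 / 2 := by
  push_cast
  rw [show ((n : ℝ) + 1) * (I / Z) = ((n : ℝ) + 1) * I / Z by ring, ← mul_div_assoc,
    div_div_div_cancel_right₀ hZ]

/-- **THE SHARPEST FORM: the mean squared jump.**  Same setting; let
`Γ_M(φ) = K[(M − M(φ))²](φ)` be the conditional mean squared one-step displacement of the
magnetisation from `φ` (for the scan: `(1/(n+1)) Σ_x ∫ min(1,e^{−ΔS}) (t' − φ_x)² ρ(t' − φ_x) dt'`, the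
mean squared ACCEPTED jump) and `⟨Γ_M⟩` its equilibrium mean.  Summable sweep-thinned series and
`ρ_g(n+1) < 1` ⇒ `τ_int,sweep(M) ≥ 2 Var(M)/((n+1) ⟨Γ_M⟩) − ½ = 2χ/⟨Γ_M⟩ − ½`
(and `⟨Γ_M⟩ ≤ δ² ā ≤ δ²` recovers the two coarser floors). -/
theorem metropolisScan_tauInt_sweep_ge_magnetisation_msd {lam : ℝ} (hlam : 0 < lam)
    (J : Fin (n + 1) → Fin (n + 1) → ℝ) {ρ : ℝ → ℝ} (hρ0 : ∀ u, 0 ≤ ρ u) (hρm : Measurable ρ)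
    (hρi : Integrable ρ) (hρ1 : ∫ u, ρ u = 1) (hρs : ∀ u, ρ (-u) = ρ u) {δ : ℝ} (hδ : 0 ≤ δ)
    (hρδ : ∀ u, δ < |u| → ρ u = 0)
    (hs : Summable fun k => (∫ φ, ((∑ y, φ y) - gibbsExpect J lam (fun ψ => ∑ y, ψ y))
        * ((metroScan J lam ρ)^[(n + 1) * (k + 1)]
            (fun ψ => (∑ y, ψ y) - gibbsExpect J lam (fun ψ => ∑ y, ψ y))) φ * gibbsWeight J lam φ)
        / ∫ φ, ((∑ y, φ y) - gibbsExpect J lam (fun ψ => ∑ y, ψ y)) ^ 2 * gibbsWeight J lam φ)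
    (hρV : (∫ φ, ((∑ y, φ y) - gibbsExpect J lam (fun ψ => ∑ y, ψ y))
        * ((metroScan J lam ρ)^[n + 1]
            (fun ψ => (∑ y, ψ y) - gibbsExpect J lam (fun ψ => ∑ y, ψ y))) φ * gibbsWeight J lam φ)
        / (∫ φ, ((∑ y, φ y) - gibbsExpect J lam (fun ψ => ∑ y, ψ y)) ^ 2 * gibbsWeight J lam φ)
        < 1) :
    2 * gibbsExpect J lam (fun φ => ((∑ y, φ y) - gibbsExpect J lam (fun ψ => ∑ y, ψ y)) ^ 2)
        / ((n + 1) * gibbsExpect J lam (fun φ => metroScan J lam ρ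
            (fun ψ => (((∑ y, ψ y) - gibbsExpect J lam (fun ψ => ∑ y, ψ y))
              - ((∑ y, φ y) - gibbsExpect J lam (fun ψ => ∑ y, ψ y))) ^ 2) φ)) - 1 / 2
      ≤ tauInt (fun k => (∫ φ, ((∑ y, φ y) - gibbsExpect J lam (fun ψ => ∑ y, ψ y))
        * ((metroScan J lam ρ)^[(n + 1) * k]
            (fun ψ => (∑ y, ψ y) - gibbsExpect J lam (fun ψ => ∑ y, ψ y))) φ * gibbsWeight J lam φ)
        / ∫ φ, ((∑ y, φ y) - gibbsExpect J lam (fun ψ => ∑ y, ψ y)) ^ 2 * gibbsWeight J lam φ) := by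
  have hco := latticePhi4Action_coercive hlam J
  set c := gibbsExpect J lam (fun ψ : Fin (n + 1) → ℝ => ∑ y, ψ y) with hc
  have hgm : Measurable (fun ψ : Fin (n + 1) → ℝ => (∑ y, ψ y) - c) :=
    (Finset.measurable_sum _ fun y _ => measurable_pi_apply y).sub measurable_const
  have hglin : ∀ φ : Fin (n + 1) → ℝ, |(∑ y, φ y) - c| ≤ (1 + |c|) * (1 + ∑ w, |φ w|) :=
    fun φ => magnetisation_linear_growth c φ
  have hg : QuadObs (fun ψ : Fin (n + 1) → ℝ => (∑ y, ψ y) - c) := quadObs_of_linear_growth hgm hglin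
  have hg2 : QuadObs (fun ψ : Fin (n + 1) → ℝ => ((∑ y, ψ y) - c) ^ 2) :=
    quadObs_sq_of_linear_growth hgm hglin
  have hfloor := RevOp.thinned_tauInt_ge_of_integral_carre_le (μ := volume) (A := QuadObs)
    (K := metroScan J lam ρ) (w := gibbsWeight J lam)
    (fun φ => (gibbsWeight_pos J lam φ).le) (quadObs_const 1)
    (fun f h hf hh => quadObs_integrable_mul_mul_gibbsWeight one_pos hco hf hh)
    (fun f h c hf hh => quadObs_add_mul hf hh c)
    (fun f hf => quadObs_metroScan J lam hρ0 hρm hρi hρ1 hδ hρδ hf)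
    (fun f h c hf hh x => metroScan_add_mul_quad J lam hρ0 hρm hρi hδ hρδ hf hh c x)
    (fun f h hf hh => metroScan_reversible_quad one_pos hco hρ0 hρm hρi hρ1 hρs hδ hρδ hf hh)
    (fun f hf => metroScan_contraction_quad one_pos hco hρ0 hρm hρi hρ1 hρs hδ hρδ hf)
    (fun φ => metroScan_one J lam hρ1 φ) hg hg2 (le_refl _) (show 0 < n + 1 by omega) hs hρV
  have hZ : gibbsZ J lam ≠ 0 := (gibbsZ_pos hlam J).ne'
  exact (msd_floor_transfer hZ n _ _).le.trans hfloor

end AcceptanceCSD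

end Summit.Ventures.LatticeQCDFlow.Exactness
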